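import Literature.Geometry.Lorentzian.KerrBoyerLindquistQuasiIsotropic
import Literature.Geometry.Lorentzian.KerrIngoingCoordPullback
import Literature.Geometry.Lorentzian.KerrSchildDivergence
import HarnessLib

/-!
# The Boyer–Lindquist slice of Kerr as a map from quasi-isotropic Cartesian coordinates, I:
# the height and twist primitives, the leaf map, its Kerr–Schild radius and smoothness

Support file (all results proved; the definitions are explicit closed-form expressions and
interval integrals, no named facts), step 3 of the statement that the Boyer–Lindquist slice of
Kerr is an exact Kerr leaf with Dafermos–Rodnianski-admissible asymptotics
(`KerrBoyerLindquistSliceIngoing.lean`, `KerrBoyerLindquistQuasiIsotropic.lean`).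

* `Kerr.BL.prim f b r = ∫_b^r f` with the fundamental theorem of calculus (`hasDerivAt_prim`) and
  smoothness (`contDiffOn_prim`), on a half-line `(ρ₀, ∞)` where `f` is smooth — uniform in the
  spin, so that sub-extremal, extremal and super-extremal parameters are treated at once;
* `Kerr.BL.rH M a = M + √(max (M² − a²) 0)` and `delta_pos_of_rH_lt` (`Δ > 0` beyond `rH`);
  the **height** `heightBL M a b = ∫_b 2Ms/Δ` and the **twist** `twistBL M a b = ∫_b a/Δ`
  (primitives of the Boyer–Lindquist slope `F′ = 2Mr/Δ` and of `dφ♯/dr = a/Δ` of step 1), smooth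
  on `(rH, ∞)` with these derivatives;
* the **leaf map** `Kerr.BL.leafRep M a b : E3 → E4`,
  `x ↦ (F(R), ((R ξ₁ − a ξ₂)/ρ, (R ξ₂ + a ξ₁)/ρ, R x₃/ρ))`, `ρ = ‖x‖`, `R = R(ρ)` the
  quasi-isotropic radius, `ξ = rot_{G(R)}(x₁, x₂)` (`G = twistBL`): the Boyer–Lindquist slice
  `{t = 0}` of Kerr parametrised by quasi-isotropic Cartesian coordinates, landing in the ingoing
  Kerr–Schild chart. We prove `leafSpatial_kerrStar` (over the point with spherical coordinates
  `(ρ, θ, φ)` the spatial leaf point is Kerr's `Y_a(R, θ, φ + G(R))`), **`radius_leafRep`** (its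
  Kerr–Schild radius is `R(ρ)`, for EVERY `x ≠ 0`, axis included, by the quartic), membership in
  `Kerr.region a r₀` (`leafRep_mem_region`), the time-independence bookkeeping, and
  **`contDiffOn_leafRep`**: the leaf map is `C^∞` on `{‖x‖ > ρ₁}` as soon as `R` maps `(ρ₁, ∞)`
  into `(rH, ∞)` (`qiRadius_gt_rH`: true for `ρ₁ ≥ √|M² − a²|/2`).

The differential of the leaf map and its identification with `J ∘ blLift` (hence the induced
metric `blHRep` via `Kerr.Ingoing.kerrBilin_jac` and `bilin_blLift_quasiIsotropic`) are the sequel.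

References: Brandt–Seidel, Phys. Rev. D 54 (1996) 1403, §II; Boyer–Lindquist 1967; Visser
arXiv:0706.0622, §4–§5; Kerr 1963.
-/

noncomputable section

open Bundle TopologicalSpace Set Module MeasureTheory Real Filter
open scoped InnerProductSpace Topology ContDiff

namespace Literature.Geometry.Lorentzian

namespace Kerr.BL

open Kerr.Ingoing

/-! ### Primitives on a half-line -/

/-- The primitive `∫_b^r f` (interval integral). [folklore] -/
def prim (f : ℝ → ℝ) (b r : ℝ) : ℝ :=
  ∫ s in b..r, f s

/-- **Fundamental theorem of calculus** for `prim` on a half-line `(ρ₀, ∞)` where `f` is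
continuous: `d/dr ∫_b^r f = f(r)` for `b, r > ρ₀`. [folklore] -/
theorem hasDerivAt_prim {f : ℝ → ℝ} {ρ₀ b r : ℝ} (hf : ContinuousOn f (Ioi ρ₀)) (hb : ρ₀ < b)
    (hr : ρ₀ < r) : HasDerivAt (prim f b) (f r) r := by
  have hsub : uIcc b r ⊆ Ioi ρ₀ := ordConnected_Ioi.uIcc_subset hb hr
  have h1 : IntervalIntegrable f volume b r := (hf.mono hsub).intervalIntegrable
  have h2 := hf.stronglyMeasurableAtFilter (μ := volume) isOpen_Ioi r hr
  have h3 : ContinuousAt f r := hf.continuousAt (isOpen_Ioi.mem_nhds hr)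
  exact intervalIntegral.integral_hasDerivAt_right h1 h2 h3

/-- The primitive is `C^∞` on the half-line when `f` is. [folklore] -/
theorem contDiffOn_prim {f : ℝ → ℝ} {ρ₀ b : ℝ} (hf : ContDiffOn ℝ ∞ f (Ioi ρ₀)) (hb : ρ₀ < b) :
    ContDiffOn ℝ ∞ (prim f b) (Ioi ρ₀) := by
  rw [contDiffOn_infty_iff_deriv_of_isOpen isOpen_Ioi]
  refine ⟨fun r hr ↦ (hasDerivAt_prim hf.continuousOn hb hr).differentiableAt.differentiableWithinAt,
    ?_⟩
  exact hf.congr fun r hr ↦ (hasDerivAt_prim hf.continuousOn hb hr).deriv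

/-! ### The horizon threshold and the height / twist primitives -/

/-- The radial threshold `rH = M + √(max (M² − a²) 0)`: the outer horizon radius `r₊` in the
sub-extremal and extremal cases, `M` in the super-extremal case; beyond it `Δ > 0`.
Boyer–Lindquist 1967; Visser arXiv:0706.0622, (E:BL2). [cite: arXiv07060622, §5] -/
def rH (M a : ℝ) : ℝ :=
  M + Real.sqrt (max (M ^ 2 - a ^ 2) 0)

/-- **`Δ(r) > 0` for `r > rH`**: `Δ = (r − M)² − (M² − a²)` and `(r − M)² > max (M² − a²) 0`.
[cite: arXiv07060622, §5] -/
theorem delta_pos_of_rH_lt {M a r : ℝ} (h : rH M a < r) : 0 < delta M a r := by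
  unfold rH at h
  have hs : 0 ≤ Real.sqrt (max (M ^ 2 - a ^ 2) 0) := Real.sqrt_nonneg _
  have h1 : Real.sqrt (max (M ^ 2 - a ^ 2) 0) < r - M := by linarith
  have h2 : max (M ^ 2 - a ^ 2) 0 < (r - M) ^ 2 := by
    have := Real.sq_sqrt (le_max_right (M ^ 2 - a ^ 2) 0)
    nlinarith
  have h3 : M ^ 2 - a ^ 2 < (r - M) ^ 2 := (le_max_left _ _).trans_lt h2
  unfold delta
  nlinarith

/-- `rH ≥ M`. [cite: arXiv07060622, §5] -/
theorem le_rH (M a : ℝ) : M ≤ rH M a := by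
  unfold rH
  have := Real.sqrt_nonneg (max (M ^ 2 - a ^ 2) 0)
  linarith

/-- The integrand of the height, `2Ms/Δ`, is `C^∞` beyond `rH`. [cite: arXiv07060622, §5] -/
theorem contDiffOn_slopeT (M a : ℝ) :
    ContDiffOn ℝ ∞ (fun s ↦ 2 * M * s / delta M a s) (Ioi (rH M a)) := by
  intro s hs
  have hΔ : delta M a s ≠ 0 := (delta_pos_of_rH_lt hs).ne'
  have hd : ContDiffAt ℝ ∞ (fun s ↦ delta M a s) s := by
    unfold delta
    exact ((contDiffAt_id.pow 2).sub (contDiffAt_const.mul contDiffAt_id)).add contDiffAt_const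
  exact ((contDiffAt_const.mul contDiffAt_id).div hd hΔ).contDiffWithinAt

/-- The integrand of the twist, `a/Δ`, is `C^∞` beyond `rH`. [cite: arXiv07060622, §5] -/
theorem contDiffOn_slopePhi (M a : ℝ) :
    ContDiffOn ℝ ∞ (fun s ↦ a / delta M a s) (Ioi (rH M a)) := by
  intro s hs
  have hΔ : delta M a s ≠ 0 := (delta_pos_of_rH_lt hs).ne'
  have hd : ContDiffAt ℝ ∞ (fun s ↦ delta M a s) s := by
    unfold delta
    exact ((contDiffAt_id.pow 2).sub (contDiffAt_const.mul contDiffAt_id)).add contDiffAt_const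
  exact (contDiffAt_const.div hd hΔ).contDiffWithinAt

/-- **The Boyer–Lindquist height** `F(r) = ∫_b^r 2Ms/Δ(s) ds`, a primitive of the slope
`F′ = 2Mr/Δ` of the slice `{t = 0}` as a graph `t* = F(r)` (step 1), based at `b`.
Visser arXiv:0706.0622, (E:BL1); Boyer–Lindquist 1967. [cite: arXiv07060622, §5] -/
def heightBL (M a b r : ℝ) : ℝ :=
  prim (fun s ↦ 2 * M * s / delta M a s) b r

/-- **The Boyer–Lindquist twist** `G(r) = ∫_b^r a/Δ(s) ds` (`φ_in = φ_BL + G`), based at `b`.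
Visser arXiv:0706.0622, (E:BL1). [cite: arXiv07060622, §5] -/
def twistBL (M a b r : ℝ) : ℝ :=
  prim (fun s ↦ a / delta M a s) b r

/-- `F′ = 2Mr/Δ = blSlopeT` beyond `rH` (for a base point `b > rH`). [cite: arXiv07060622, §5] -/
theorem hasDerivAt_heightBL {M a b r : ℝ} (hb : rH M a < b) (hr : rH M a < r) :
    HasDerivAt (heightBL M a b) (blSlopeT M a r) r :=
  hasDerivAt_prim (contDiffOn_slopeT M a).continuousOn hb hr

/-- `G′ = a/Δ = blSlopePhi` beyond `rH`. [cite: arXiv07060622, §5] -/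
theorem hasDerivAt_twistBL {M a b r : ℝ} (hb : rH M a < b) (hr : rH M a < r) :
    HasDerivAt (twistBL M a b) (blSlopePhi M a r) r :=
  hasDerivAt_prim (contDiffOn_slopePhi M a).continuousOn hb hr

/-- The height is `C^∞` on `(rH, ∞)`. [cite: arXiv07060622, §5] -/
theorem contDiffOn_heightBL {M a b : ℝ} (hb : rH M a < b) :
    ContDiffOn ℝ ∞ (heightBL M a b) (Ioi (rH M a)) :=
  contDiffOn_prim (contDiffOn_slopeT M a) hb

/-- The twist is `C^∞` on `(rH, ∞)`. [cite: arXiv07060622, §5] -/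
theorem contDiffOn_twistBL {M a b : ℝ} (hb : rH M a < b) :
    ContDiffOn ℝ ∞ (twistBL M a b) (Ioi (rH M a)) :=
  contDiffOn_prim (contDiffOn_slopePhi M a) hb

/-! ### The quasi-isotropic radius beyond the threshold -/

/-- The quasi-isotropic threshold `ρH = √|M² − a²|/2` (the quasi-isotropic horizon radius in the
sub-extremal case). Brandt–Seidel 1996, §II. [cite: BrandtSeidel1996, §II] -/
def rhoH (M a : ℝ) : ℝ :=
  Real.sqrt |M ^ 2 - a ^ 2| / 2

/-- `ρH ≥ 0`. [cite: BrandtSeidel1996, §II] -/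
theorem rhoH_nonneg (M a : ℝ) : 0 ≤ rhoH M a := by
  unfold rhoH; positivity

/-- **Beyond the threshold the quasi-isotropic radius is beyond `rH`**: for `ρ > ρH`,
`R(ρ) > rH` (`R − M = ρ + (M² − a²)/(4ρ)`; for `M² ≥ a²` this is `(√ρ − d/2√ρ)² + d > d = √(M²−a²)`
unless `ρ = d/2 = ρH`, and for `M² < a²` it is `(4ρ² − |M² − a²|)/(4ρ) > 0`). Brandt–Seidel 1996, §II.
[cite: BrandtSeidel1996, §II] -/
theorem qiRadius_gt_rH {M a ρ : ℝ} (hρ : rhoH M a < ρ) : rH M a < qiRadius M a ρ := by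
  have hρ0 : 0 < ρ := (rhoH_nonneg M a).trans_lt hρ
  unfold rhoH at hρ
  have hsq : Real.sqrt |M ^ 2 - a ^ 2| < 2 * ρ := by linarith
  have habs : |M ^ 2 - a ^ 2| < 4 * ρ ^ 2 := by
    have h0 : 0 ≤ Real.sqrt |M ^ 2 - a ^ 2| := Real.sqrt_nonneg _
    have := Real.sq_sqrt (abs_nonneg (M ^ 2 - a ^ 2))
    nlinarith
  unfold rH qiRadius
  rcases le_or_gt 0 (M ^ 2 - a ^ 2) with hd | hd
  · -- sub-extremal / extremal: `d² = M² − a² ≥ 0`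
    rw [max_eq_left hd]
    rw [abs_of_nonneg hd] at habs hsq
    set d := Real.sqrt (M ^ 2 - a ^ 2) with hd_def
    have hdsq : d ^ 2 = M ^ 2 - a ^ 2 := Real.sq_sqrt hd
    have hd0 : 0 ≤ d := Real.sqrt_nonneg _
    -- `ρ + d²/(4ρ) − d = (2ρ − d)²/(4ρ) > 0` since `2ρ ≠ d` (indeed `2ρ > d`)
    have key : ρ + (M ^ 2 - a ^ 2) / (4 * ρ) - d = (2 * ρ - d) ^ 2 / (4 * ρ) := by
      rw [← hdsq]; field_simp; ring
    have hne : 2 * ρ - d ≠ 0 := by linarith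
    have hpos : 0 < (2 * ρ - d) ^ 2 / (4 * ρ) := by positivity
    linarith
  · -- super-extremal: `M² − a² < 0`
    rw [max_eq_right hd.le, Real.sqrt_zero, add_zero]
    rw [abs_of_neg hd] at habs
    have key : 0 < ρ + (M ^ 2 - a ^ 2) / (4 * ρ) := by
      rw [show ρ + (M ^ 2 - a ^ 2) / (4 * ρ) = (4 * ρ ^ 2 + (M ^ 2 - a ^ 2)) / (4 * ρ) by
        field_simp]
      apply div_pos _ (by positivity)
      linarith
    linarith

/-- Beyond the threshold `q(ρ) > 0` (`4ρ² > |M² − a²| ≥ M² − a²`). [cite: BrandtSeidel1996, §II] -/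
theorem qiRoot_pos_of_rhoH_lt {M a ρ : ℝ} (hρ : rhoH M a < ρ) : 0 < qiRoot M a ρ := by
  have hρ0 : 0 < ρ := (rhoH_nonneg M a).trans_lt hρ
  refine qiRoot_pos M a hρ0 ?_
  unfold rhoH at hρ
  have h0 : 0 ≤ Real.sqrt |M ^ 2 - a ^ 2| := Real.sqrt_nonneg _
  have := Real.sq_sqrt (abs_nonneg (M ^ 2 - a ^ 2))
  have hle : M ^ 2 - a ^ 2 ≤ |M ^ 2 - a ^ 2| := le_abs_self _
  nlinarith

/-- Beyond the threshold `R(ρ) > 0` when `0 ≤ M` (`R > rH ≥ M ≥ 0`). [cite: BrandtSeidel1996, §II] -/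
theorem qiRadius_pos_of_rhoH_lt {M a ρ : ℝ} (hM : 0 ≤ M) (hρ : rhoH M a < ρ) : 0 < qiRadius M a ρ :=
  (hM.trans (le_rH M a)).trans_lt (qiRadius_gt_rH hρ)

/-! ### The leaf map -/

/-- The planar rotation of `(x₁, x₂)` by the angle `α` (the `x₃`-axis fixed). [folklore] -/
def rotXY (α : ℝ) (x : E3) : E3 :=
  !₂[x 0 * cos α - x 1 * sin α, x 0 * sin α + x 1 * cos α, x 2]

/-- Component formula. [folklore] -/
@[simp] theorem rotXY_apply_zero (α : ℝ) (x : E3) : rotXY α x 0 = x 0 * cos α - x 1 * sin α := rfl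

/-- Component formula. [folklore] -/
@[simp] theorem rotXY_apply_one (α : ℝ) (x : E3) : rotXY α x 1 = x 0 * sin α + x 1 * cos α := rfl

/-- Component formula. [folklore] -/
@[simp] theorem rotXY_apply_two (α : ℝ) (x : E3) : rotXY α x 2 = x 2 := rfl

/-- `(rot x)₁² + (rot x)₂² = x₁² + x₂²`. [folklore] -/
theorem rotXY_sq_add_sq (α : ℝ) (x : E3) :
    rotXY α x 0 ^ 2 + rotXY α x 1 ^ 2 = x 0 ^ 2 + x 1 ^ 2 := by
  rw [rotXY_apply_zero, rotXY_apply_one]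
  linear_combination (x 0 ^ 2 + x 1 ^ 2) * sin_sq_add_cos_sq α

variable (M a b : ℝ)

/-- **The spatial leaf point** over the quasi-isotropic Cartesian point `x`:
`Y(x) = ((R ξ₁ − a ξ₂)/ρ, (R ξ₂ + a ξ₁)/ρ, R x₃/ρ)`, `ρ = ‖x‖`, `R = R(ρ)` the quasi-isotropic
radius, `ξ = rot_{G(R)}(x₁, x₂)`, `G` the twist — i.e. Kerr's `Y_a(R, θ, φ_BL + G(R))` written
without angles (`x + iy = (R + ia) e^{i(φ_BL + G)} sin θ`, `e^{iφ_BL} sin θ = (x₁ + ix₂)/ρ`).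
Brandt–Seidel 1996, §II; Visser arXiv:0706.0622, §4–§5. [cite: BrandtSeidel1996, §II] -/
def leafSpatial (x : E3) : E3 :=
  !₂[(qiRadius M a ‖x‖ * rotXY (twistBL M a b (qiRadius M a ‖x‖)) x 0 -
        a * rotXY (twistBL M a b (qiRadius M a ‖x‖)) x 1) / ‖x‖,
    (qiRadius M a ‖x‖ * rotXY (twistBL M a b (qiRadius M a ‖x‖)) x 1 +
        a * rotXY (twistBL M a b (qiRadius M a ‖x‖)) x 0) / ‖x‖,
    qiRadius M a ‖x‖ * x 2 / ‖x‖]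

/-- **The leaf map** `x ↦ (F(R(‖x‖)), Y(x))`: the Boyer–Lindquist slice `{t = 0}` of Kerr in
quasi-isotropic Cartesian coordinates, as a map into the ingoing Kerr–Schild chart `E4`.
Brandt–Seidel 1996, §II; Visser arXiv:0706.0622, §5. [cite: BrandtSeidel1996, §II] -/
def leafRep (x : E3) : E4 :=
  E4.ofTimeSpace (heightBL M a b (qiRadius M a ‖x‖)) (leafSpatial M a b x)

/-- Component formula. [cite: BrandtSeidel1996, §II] -/
theorem leafSpatial_apply_zero (x : E3) :
    leafSpatial M a b x 0 =
      (qiRadius M a ‖x‖ * rotXY (twistBL M a b (qiRadius M a ‖x‖)) x 0 -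
        a * rotXY (twistBL M a b (qiRadius M a ‖x‖)) x 1) / ‖x‖ := rfl

/-- Component formula. [cite: BrandtSeidel1996, §II] -/
theorem leafSpatial_apply_one (x : E3) :
    leafSpatial M a b x 1 =
      (qiRadius M a ‖x‖ * rotXY (twistBL M a b (qiRadius M a ‖x‖)) x 1 +
        a * rotXY (twistBL M a b (qiRadius M a ‖x‖)) x 0) / ‖x‖ := rfl

/-- Component formula. [cite: BrandtSeidel1996, §II] -/
theorem leafSpatial_apply_two (x : E3) :
    leafSpatial M a b x 2 = qiRadius M a ‖x‖ * x 2 / ‖x‖ := rfl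

/-- The spatial part of the leaf map is `leafSpatial`, its time is the height. [cite: BrandtSeidel1996, §II] -/
@[simp] theorem spatial_leafRep (x : E3) : E4.spatial (leafRep M a b x) = leafSpatial M a b x := by
  rw [leafRep, E4.spatial_ofTimeSpace]

/-- **Over the point with spherical coordinates `(ρ, θ, φ)` the spatial leaf point is Kerr's
`Y_a(R(ρ), θ, φ + G(R(ρ)))`** (`ρ > 0`; `Y_0(ρ, θ, φ) = ρ n̂(θ, φ)`). Visser arXiv:0706.0622, §4.
[cite: arXiv07060622, §4] -/
theorem leafSpatial_kerrStar {ρ : ℝ} (hρ : 0 < ρ) (θ φ : ℝ) :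
    leafSpatial M a b (kerrStar 0 ρ θ φ) =
      kerrStar a (qiRadius M a ρ) θ (φ + twistBL M a b (qiRadius M a ρ)) := by
  have hn : ‖kerrStar 0 ρ θ φ‖ = ρ := by
    have h := norm_sq_kerrStar 0 ρ θ φ
    simp only [ne_eq, OfNat.ofNat_ne_zero, not_false_eq_true, zero_pow, zero_mul, add_zero] at h
    rw [← Real.sqrt_sq (norm_nonneg _), h, Real.sqrt_sq hρ.le]
  ext i
  fin_cases i
  · show leafSpatial M a b (kerrStar 0 ρ θ φ) 0 =
      kerrStar a (qiRadius M a ρ) θ (φ + twistBL M a b (qiRadius M a ρ)) 0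
    rw [leafSpatial_apply_zero, hn, rotXY_apply_zero, rotXY_apply_one, kerrStar_apply_zero,
      kerrStar_apply_one, kerrStar_apply_zero, cos_add, sin_add]
    field_simp
    ring
  · show leafSpatial M a b (kerrStar 0 ρ θ φ) 1 =
      kerrStar a (qiRadius M a ρ) θ (φ + twistBL M a b (qiRadius M a ρ)) 1
    rw [leafSpatial_apply_one, hn, rotXY_apply_zero, rotXY_apply_one, kerrStar_apply_zero,
      kerrStar_apply_one, kerrStar_apply_one, cos_add, sin_add]
    field_simp
    ring
  · show leafSpatial M a b (kerrStar 0 ρ θ φ) 2 =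
      kerrStar a (qiRadius M a ρ) θ (φ + twistBL M a b (qiRadius M a ρ)) 2
    rw [leafSpatial_apply_two, hn, kerrStar_apply_two, kerrStar_apply_two]
    field_simp

/-- `‖Y(x)‖² = R² + a² (x₁² + x₂²)/ρ²` (`= R² + a² sin²θ`), for `x ≠ 0`. [cite: arXiv07060622, §4] -/
theorem norm_sq_leafSpatial {x : E3} (hx : x ≠ 0) :
    ‖leafSpatial M a b x‖ ^ 2 =
      qiRadius M a ‖x‖ ^ 2 + a ^ 2 * ((x 0 ^ 2 + x 1 ^ 2) / ‖x‖ ^ 2) := by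
  have hρ : ‖x‖ ≠ 0 := norm_ne_zero_iff.2 hx
  have hn : ‖x‖ ^ 2 = x 0 ^ 2 + x 1 ^ 2 + x 2 ^ 2 := E3.norm_sq x
  have hrot := rotXY_sq_add_sq (twistBL M a b (qiRadius M a ‖x‖)) x
  set ξ := rotXY (twistBL M a b (qiRadius M a ‖x‖)) x with hξ
  rw [E3.norm_sq, leafSpatial_apply_zero, leafSpatial_apply_one, leafSpatial_apply_two]
  rw [← hξ]
  field_simp
  -- `(Rξ₀ − aξ₁)² + (Rξ₁ + aξ₀)² = (R² + a²)(ξ₀² + ξ₁²) = (R² + a²)(x₀² + x₁²)`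
  linear_combination (qiRadius M a ‖x‖ ^ 2 + a ^ 2) * hrot - qiRadius M a ‖x‖ ^ 2 * hn

/-- **The Kerr–Schild radius of the leaf point is the quasi-isotropic radius `R(‖x‖)`**, for
every `x ≠ 0` with `R(‖x‖) > 0` (axis included): `Y(x)` solves the defining quartic with root `R`
(`‖Y‖² − a² = R² − a² x₃²/ρ²·(ρ²/x₃²)…`, precisely `R⁴ − (‖Y‖² − a²)R² − a²Y₃² = a²R²(1 − ‖x‖²/ρ²) = 0`).
Visser arXiv:0706.0622, (35). [cite: arXiv07060622, (35)] -/
theorem radius_leafRep {x : E3} (hx : x ≠ 0) (hR : 0 < qiRadius M a ‖x‖) :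
    radius a (leafRep M a b x) = qiRadius M a ‖x‖ := by
  have hρ : ‖x‖ ≠ 0 := norm_ne_zero_iff.2 hx
  have hn : ‖x‖ ^ 2 = x 0 ^ 2 + x 1 ^ 2 + x 2 ^ 2 := E3.norm_sq x
  refine radius_eq_of_pos_of_quartic hR ?_
  rw [leafRep, E4.spatialNorm_ofTimeSpace, norm_sq_leafSpatial M a b hx,
    show (E4.ofTimeSpace (heightBL M a b (qiRadius M a ‖x‖)) (leafSpatial M a b x)) 3 =
      leafSpatial M a b x 2 from E4.ofTimeSpace_apply_succ _ _ 2, leafSpatial_apply_two]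
  field_simp
  linear_combination (a ^ 2 * qiRadius M a ‖x‖ ^ 2) * hn

/-- **The leaf map lands in the Kerr–Schild chart domain `Kerr.region a r₀`** over
`{‖x‖ > ρ₁}` as soon as `R(ρ) > max r₀ 0` there; stated pointwise. [cite: arXiv07060622, §4] -/
theorem leafRep_mem_region {r₀ : ℝ} {x : E3} (hx : x ≠ 0) (hR : max r₀ 0 < qiRadius M a ‖x‖) :
    leafRep M a b x ∈ region a r₀ := by
  rw [mem_region, radius_leafRep M a b hx ((le_max_right r₀ 0).trans_lt hR)]
  exact hR

/-! ### Smoothness -/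

/-- The quasi-isotropic radius is `C^∞` off `ρ = 0`. [cite: BrandtSeidel1996, §II] -/
theorem contDiffAt_qiRadius {ρ : ℝ} (hρ : ρ ≠ 0) {n : WithTop ℕ∞} :
    ContDiffAt ℝ n (qiRadius M a) ρ := by
  unfold qiRadius
  exact (contDiffAt_id.add contDiffAt_const).add
    (contDiffAt_const.div (contDiffAt_const.mul contDiffAt_id) (by positivity))

/-- `x ↦ R(‖x‖)` is `C^∞` off the origin. [cite: BrandtSeidel1996, §II] -/
theorem contDiffAt_qiRadius_norm {x : E3} (hx : x ≠ 0) {n : WithTop ℕ∞} :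
    ContDiffAt ℝ n (fun x : E3 ↦ qiRadius M a ‖x‖) x :=
  (contDiffAt_qiRadius M a (norm_ne_zero_iff.2 hx)).comp x (contDiffAt_norm ℝ hx)

variable {M a b}

/-- `x ↦ G(R(‖x‖))` and `x ↦ F(R(‖x‖))` are `C^∞` at the points `‖x‖ > ρH` (`R(‖x‖) > rH`), for a
base point `b > rH`. [cite: BrandtSeidel1996, §II] -/
theorem contDiffAt_twistBL_comp {x : E3} (hb : rH M a < b) (hx : rhoH M a < ‖x‖) :
    ContDiffAt ℝ ∞ (fun x : E3 ↦ twistBL M a b (qiRadius M a ‖x‖)) x := by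
  have hx0 : x ≠ 0 := by
    intro h0; rw [h0, norm_zero] at hx; exact absurd hx (not_lt.2 (rhoH_nonneg M a))
  have hR : rH M a < qiRadius M a ‖x‖ := qiRadius_gt_rH hx
  have h1 : ContDiffAt ℝ ∞ (twistBL M a b) (qiRadius M a ‖x‖) :=
    (contDiffOn_twistBL hb).contDiffAt (isOpen_Ioi.mem_nhds hR)
  exact h1.comp x (contDiffAt_qiRadius_norm M a hx0)

/-- The height composed with the quasi-isotropic radius is `C^∞` beyond the threshold.
[cite: BrandtSeidel1996, §II] -/
theorem contDiffAt_heightBL_comp {x : E3} (hb : rH M a < b) (hx : rhoH M a < ‖x‖) :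
    ContDiffAt ℝ ∞ (fun x : E3 ↦ heightBL M a b (qiRadius M a ‖x‖)) x := by
  have hx0 : x ≠ 0 := by
    intro h0; rw [h0, norm_zero] at hx; exact absurd hx (not_lt.2 (rhoH_nonneg M a))
  have hR : rH M a < qiRadius M a ‖x‖ := qiRadius_gt_rH hx
  have h1 : ContDiffAt ℝ ∞ (heightBL M a b) (qiRadius M a ‖x‖) :=
    (contDiffOn_heightBL hb).contDiffAt (isOpen_Ioi.mem_nhds hR)
  exact h1.comp x (contDiffAt_qiRadius_norm M a hx0)

/-- A map into `E3` is `C^n` at a point iff its three components are. [folklore] -/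
private theorem contDiffAt_e3_iff {f : E3 → E3} {x : E3} {n : WithTop ℕ∞} :
    ContDiffAt ℝ n f x ↔ ∀ i, ContDiffAt ℝ n (fun y ↦ f y i) x := by
  rw [← contDiffWithinAt_univ, contDiffWithinAt_euclidean]
  simp only [contDiffWithinAt_univ]

/-- **The spatial leaf map is `C^∞` beyond the threshold** `‖x‖ > ρH` (for a base point
`b > rH`): its components are rational in `x`, `‖x‖`, `R(‖x‖)` and `cos/sin` of the twist.
[cite: BrandtSeidel1996, §II] -/
theorem contDiffAt_leafSpatial {x : E3} (hb : rH M a < b) (hx : rhoH M a < ‖x‖) :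
    ContDiffAt ℝ ∞ (leafSpatial M a b) x := by
  have hx0 : x ≠ 0 := by
    intro h0; rw [h0, norm_zero] at hx; exact absurd hx (not_lt.2 (rhoH_nonneg M a))
  have hρ : ContDiffAt ℝ ∞ (fun y : E3 ↦ ‖y‖) x := contDiffAt_norm ℝ hx0
  have hR : ContDiffAt ℝ ∞ (fun y : E3 ↦ qiRadius M a ‖y‖) x := contDiffAt_qiRadius_norm M a hx0
  have hG : ContDiffAt ℝ ∞ (fun y : E3 ↦ twistBL M a b (qiRadius M a ‖y‖)) x :=
    contDiffAt_twistBL_comp hb hx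
  have hc : ContDiffAt ℝ ∞ (fun y : E3 ↦ cos (twistBL M a b (qiRadius M a ‖y‖))) x := hG.cos
  have hs : ContDiffAt ℝ ∞ (fun y : E3 ↦ sin (twistBL M a b (qiRadius M a ‖y‖))) x := hG.sin
  have h0 : ContDiffAt ℝ ∞ (fun y : E3 ↦ y 0) x := ((EuclideanSpace.proj (0 : Fin 3) : E3 →L[ℝ] ℝ).contDiff (n := ∞)).contDiffAt
  have h1 : ContDiffAt ℝ ∞ (fun y : E3 ↦ y 1) x := ((EuclideanSpace.proj (1 : Fin 3) : E3 →L[ℝ] ℝ).contDiff (n := ∞)).contDiffAt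
  have h2 : ContDiffAt ℝ ∞ (fun y : E3 ↦ y 2) x := ((EuclideanSpace.proj (2 : Fin 3) : E3 →L[ℝ] ℝ).contDiff (n := ∞)).contDiffAt
  have hξ0 : ContDiffAt ℝ ∞ (fun y : E3 ↦ rotXY (twistBL M a b (qiRadius M a ‖y‖)) y 0) x := by
    simp only [rotXY_apply_zero]
    exact (h0.mul hc).sub (h1.mul hs)
  have hξ1 : ContDiffAt ℝ ∞ (fun y : E3 ↦ rotXY (twistBL M a b (qiRadius M a ‖y‖)) y 1) x := by
    simp only [rotXY_apply_one]
    exact (h0.mul hs).add (h1.mul hc)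
  have hρ0 : ‖x‖ ≠ 0 := norm_ne_zero_iff.2 hx0
  rw [contDiffAt_e3_iff]
  intro i
  fin_cases i
  · show ContDiffAt ℝ ∞ (fun y ↦ leafSpatial M a b y 0) x
    simp only [leafSpatial_apply_zero]
    exact ((hR.mul hξ0).sub (contDiffAt_const.mul hξ1)).div hρ hρ0
  · show ContDiffAt ℝ ∞ (fun y ↦ leafSpatial M a b y 1) x
    simp only [leafSpatial_apply_one]
    exact ((hR.mul hξ1).add (contDiffAt_const.mul hξ0)).div hρ hρ0
  · show ContDiffAt ℝ ∞ (fun y ↦ leafSpatial M a b y 2) x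
    simp only [leafSpatial_apply_two]
    exact ((hR.mul h2)).div hρ hρ0

/-- **The leaf map is `C^∞` beyond the threshold** `‖x‖ > ρH` (base point `b > rH`).
[cite: BrandtSeidel1996, §II] -/
theorem contDiffAt_leafRep {x : E3} (hb : rH M a < b) (hx : rhoH M a < ‖x‖) :
    ContDiffAt ℝ ∞ (leafRep M a b) x := by
  have h : leafRep M a b = fun x ↦ heightBL M a b (qiRadius M a ‖x‖) • E4.basisVector 0 +
      E4.spaceEmbed (leafSpatial M a b x) := by
    funext x
    rw [leafRep, E4.ofTimeSpace_eq_smul_add']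
  rw [h]
  exact ((contDiffAt_heightBL_comp hb hx).smul contDiffAt_const).add
    (E4.spaceEmbed.contDiff.contDiffAt.comp x (contDiffAt_leafSpatial hb hx))

/-- The leaf map is `C^∞` on the open set `{‖x‖ > ρ₁}` for every `ρ₁ ≥ ρH`. [cite: BrandtSeidel1996, §II] -/
theorem contDiffOn_leafRep {ρ₁ : ℝ} (hb : rH M a < b) (hρ₁ : rhoH M a ≤ ρ₁) :
    ContDiffOn ℝ ∞ (leafRep M a b) {x : E3 | ρ₁ < ‖x‖} := fun _ hx ↦
  (contDiffAt_leafRep hb (hρ₁.trans_lt hx)).contDiffWithinAt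

end Kerr.BL

end Literature.Geometry.Lorentzian

end
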